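import Summits.HodgeConjecture.HodgeConjecture.Theorems.Ring2AbelianAllAndreTwistedSquareNonsplit
import Literature.AlgebraicGeometry.Deligne1982.PolarizedHyperbolicWeilTypeCMAnchor
import Literature.AlgebraicGeometry.HodgeTheory.WeilTypeProducts
import Literature.AlgebraicGeometry.HodgeTheory.PowSuccProductCone
import HarnessLib

/-!
# Ring 2 · AbelianAll — ANDRÉ AXIS, PART O-d: EVERY NON-SPLIT COMPONENT `(2k+1, d, δ)` CONTAINS A POLARIZED WEIL VARIETY SATISFYING
  THE HODGE CONJECTURE OUTRIGHT — Deligne's `E^{2k+1} × Ē^{2k+1}` with the weight-`m` product polarization (hypothesis-free existence)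

HONEST FRAMING (sub-cell `pub-hodge-ring2-ab-*`, verbatim): research route, not a corollary; conditional on HC_CM plus
one named minimal statement. (Cell `pub-hodge-ring2`, verbatim: research route conditional on HC_CM; not a corollary;
Q11.4-sentence-2 already refuted in dim ≥ 3.) `HC_CM` does not occur in this file. No definition, no named fact, no `sorry`;
ABELIAN-VARIETY level; every statement below is HYPOTHESIS-FREE apart from `d ≥ 1`, `k ≥ 1` and the sign of the class.

CONTEXT. Parts O-a/O-b (this gen) typed the anchors `T × T̄ = (T × T, φ × (−φ))` of the André-axis rows: Weil type `(g, d)` for every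
`T`, discriminant class `[(−m)^g]` of the weight-`m` Segre polarization, polarized NON-split for `g` odd and `m ∉ Nm(K_dˣ)`, and HC when
`T` is a prime-dimensional CM variety; part O-c made the pencil rows through such a chart unconditional at the chart. This file records the
EXISTENCE half, with no input at all: for every `d ≥ 1` the tree CONSTRUCTS a CM elliptic curve `(E₀, ψ₀)`, `ψ₀² = −d`
(`Literature.NumberTheory.EllipticCurves.CMEndomorphism.exists_cmCurve_sqrt_neg`, the lattice `ℤ + ℤ√−d`), the diagonal `K`-structure on
`E₀^{n+1} = E₀.powSucc n` (§1), and the Hodge conjecture for every power of a power of an elliptic curve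
(`Deligne1982.hodgeConjectureFor_powSucc_powSucc`, fact-free). Hence:

* §2 **`exists_hodge_polarized_weilVariety_of_class` — for every `k ≥ 1`, `d ≥ 1` and EVERY NEGATIVE class `[q] ∈ ℚˣ/Nm(K_dˣ)` there is a
  POLARIZED abelian variety of Weil type `(2k+1, d)` — namely `E₀^{2k+1} × Ē₀^{2k+1}` with a weight-`m` Segre class — whose `K`-symmetrised
  hyperplane class has non-degenerate discriminant class `[q]`, whose Weil plane is ALGEBRAIC, and which satisfies the HODGE CONJECTURE in
  every codimension.** (van Geemen 4.14: the components with `(−1)^{2k+1}·q > 0` are exactly the negative classes; ab-weil-1's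
  `weilClassesComponent_inhabited_of_weilSign_eq` inhabited every right-sign component by the CM tower with a non-zero rational Weil class —
  here, for odd half-dimension, the inhabitant carries HC outright and is the André-axis anchor of part O-c.)
* §3 **SIXFOLDS: `exists_hodge_nonsplit_weilSixfold_of_class`** — for every `d ≥ 1` and every negative class `[q] ≠ [−1]`: a polarized Weil
  sixfold `(A, φ, h_K)` of class `[q]`, NOT hyperbolic (non-split component `(3, d, [q])`), of Weil type `(3, d)`, with `W_K ⊆ N³(A)` and
  `HodgeConjectureFor A` — so **every non-split sixfold component `(3, d, δ)` contains an UNCONDITIONAL ANCHOR `E₀³ × Ē₀³` through which the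
  André-axis row of part O-c (`weilClassesOf_le_algebraicClasses_forall_of_lefschetzB_of_ellipticPowerTwistedSquareChart`) reads: on every compact
  pencil of the component with its `K`-action through (a chart `K`-isogenous to) it, `B⋆` of the ONE 7-fold ⟹ the Weil Hodge conjecture for
  EVERY member, fact-free.** `…_gaussian_three`: `K = ℚ(i)`, class `[−3]`.

HONEST REMARKS. Nothing here is a case of the Hodge conjecture beyond powers of CM elliptic curves (Tate–Murasaki / Lefschetz (1,1), tree
theorems); the general member of a non-split component is untouched; «non-split» is the POLARIZED notion (part O-b's remark: absolutely every
`T × T̄` with `dim T` odd is split through the weight-1 class). Existence of compact pencils with global `K`-action through the anchor is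
André-type input, not constructed. Nothing minimal claimed; N104 untouched.

## References

* [vanGeemen1994HodgeAV] B. van Geemen, LNM 1594 (1994), 4.14, Lemma 5.2 (1)–(4), 5.3–5.4 and (5.4.1), Thm. 4.3.
* [Deligne1982HodgeCycles] P. Deligne (notes by J. Milne), LNM 900 (1982), §4 Prop. 4.4, Thm. 4.8 and Remark 4.10 (the CM points `Eⁿ ⊗ …`).
* [Andre1996Motifs] Y. André, Publ. Math. IHÉS 83 (1996), §6.3 Lemme 6.3.3 and Remarque 2 (p. 33).
* [Landherr1936HermitianForms] W. Landherr, Abh. Math. Sem. Hamburg 11 (1936) 245–248. [Serre1973] J.-P. Serre, Ch. III §1.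
-/

set_option linter.dupNamespace false

noncomputable section

open CategoryTheory
open Literature.AlgebraicGeometry Literature.AlgebraicGeometry.Motives
open Literature.AlgebraicGeometry.HodgeTheory Literature.AlgebraicGeometry.VanGeemen1994
open Literature.AlgebraicTopology.SingularHomology
open Literature.NumberTheory.EllipticCurves.CMEndomorphism (exists_cmCurve_sqrt_neg)

namespace Summit.HodgeConjecture.HodgeConjecture.Ring2.AbelianAll

/-! ## §1 The diagonal `K`-structure on a power of a CM elliptic curve -/

section Diagonal

variable {E₀ : AbelianVariety ℂ} {d : ℕ}

/-- **The diagonal `K`-structure on `E₀^{n+1}`**: an endomorphism `ψ₀` of `E₀` with `ψ₀² = −d` induces on every `E₀.powSucc n` an endomorphism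
`φ_n = φ_{n−1} × ψ₀` with `φ_n² = −d` (componentwise; `prodLift_comp_self_eq_neg`). [cite: Deligne1982HodgeCycles, §4 Remark 4.10]
[cite: vanGeemen1994HodgeAV, 5.3] -/
theorem exists_sq_eq_neg_powSucc (ψ₀ : E₀ ⟶ E₀) (hψ : ψ₀ ≫ ψ₀ = -(d • 𝟙 E₀)) :
    ∀ n : ℕ, ∃ φ : E₀.powSucc n ⟶ E₀.powSucc n, φ ≫ φ = -(d • 𝟙 (E₀.powSucc n))
  | 0 => ⟨ψ₀, hψ⟩
  | n + 1 => by
    obtain ⟨φ, hφ⟩ := exists_sq_eq_neg_powSucc ψ₀ hψ n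
    exact ⟨AbelianVariety.prodLift (AbelianVariety.fst _ _ ≫ φ) (AbelianVariety.snd _ _ ≫ ψ₀), prodLift_comp_self_eq_neg hφ hψ⟩

/-- **For every `d ≥ 1` and every `n` there is an abelian `(n+1)`-fold with `ℚ(√−d)`-multiplication**, namely `E₀^{n+1}` for the CM elliptic
curve `ℂ/(ℤ + ℤ√−d)` of the tree (`exists_cmCurve_sqrt_neg`) with the diagonal structure. [cite: vanGeemen1994HodgeAV, 5.3]
[cite: Deligne1982HodgeCycles, §4 Remark 4.10] -/
theorem exists_ellipticPower_sq_eq_neg (d : ℕ) (hd : 0 < d) (n : ℕ) :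
    ∃ (E₀ : AbelianVariety ℂ) (φ : E₀.powSucc n ⟶ E₀.powSucc n), E₀.dim = 1 ∧ (E₀.powSucc n).dim = n + 1 ∧
      φ ≫ φ = -(d • 𝟙 (E₀.powSucc n)) := by
  obtain ⟨E₀, ψ₀, hE, hψ⟩ := exists_cmCurve_sqrt_neg d hd
  obtain ⟨φ, hφ⟩ := exists_sq_eq_neg_powSucc ψ₀ hψ n
  exact ⟨E₀, φ, hE, by rw [dim_powSucc', hE, mul_one], hφ⟩

end Diagonal

/-! ## §2 Every negative class is realised by a polarized `E₀^{2k+1} × Ē₀^{2k+1}` satisfying the Hodge conjecture -/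

section Inhabitants

/-- **EVERY POLARIZED COMPONENT `(2k+1, d, [q])`, `q < 0`, CONTAINS A WEIL VARIETY SATISFYING THE HODGE CONJECTURE OUTRIGHT** (`k ≥ 1`, `d ≥ 1`;
hypothesis-free otherwise): there are an abelian variety `A` — the twisted square `E₀^{2k+1} × Ē₀^{2k+1}` of a power of the CM curve `ℂ/(ℤ + ℤ√−d)`
— an endomorphism `φ` with `φ² = −d`, a projective embedding `e` and a rational ambient class `a ≠ 0` such that `dim A = 2(2k+1)`, `(A, φ)` is of Weil
type `(2k+1, d)`, the `K`-symmetrised hyperplane class `d·e^*a + φ^*e^*a` carries a non-degenerate discriminant witness of class `[q]` (part O-b,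
weight-`m` Segre polarization, `[q] = [−m]`), the Weil plane `W_K(A, φ) ⊆ N^{2k+1}(A)` is algebraic, and `A` satisfies the Hodge conjecture in
every codimension (`Deligne1982.hodgeConjectureFor_powSucc_powSucc`: `A = (E₀.powSucc 2k).powSucc 1`). [cite: vanGeemen1994HodgeAV, 4.14, 5.3 and Thm. 4.3]
[cite: Deligne1982HodgeCycles, §4 Prop. 4.4 and Remark 4.10] -/
theorem exists_hodge_polarized_weilVariety_of_class (k d : ℕ) (hk : 1 ≤ k) (hd : 0 < d) (q : ℚˣ) (hq : (q : ℚ) < 0) :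
    ∃ (A : AbelianVariety ℂ) (φ : A ⟶ A) (e : ProjectiveEmbedding A.X) (a : complexBetti (projectiveSpace e.n ℂ) 2),
      IsRationalClass a ∧ a ≠ 0 ∧ A.dim = 2 * (2 * k + 1) ∧ φ ≫ φ = -(d • 𝟙 A) ∧ IsWeilType A φ (2 * k + 1) d ∧
      HasWeilDiscriminantNondeg A φ (2 * k + 1) d
        ((d : ℂ) • complexBetti.map e.ι 2 a + complexBetti.map φ.hom.hom.hom 2 (complexBetti.map e.ι 2 a)) (QuotientGroup.mk q) ∧
      weilClassesOf A φ (2 * k + 1) d ≤ algebraicClasses A.X (2 * k + 1) ∧ HodgeConjectureFor A.dim A.X := by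
  obtain ⟨E₀, φT, hE, hT, hφT⟩ := exists_ellipticPower_sq_eq_neg d hd (2 * k)
  obtain ⟨e, a, ha, ha0, hW, hδ, hWalg⟩ := exists_polarized_twistedSquare_of_class hk hT hd hφT q hq
  exact ⟨_, _, e, a, ha, ha0, dim_twistedSquare hT, twistedSquare_comp_self hφT, hW, hδ, hWalg,
    Deligne1982.hodgeConjectureFor_powSucc_powSucc hE (2 * k) 1⟩

end Inhabitants

/-! ## §3 Sixfolds: every non-split component `(3, d, δ)` has an unconditional André anchor `E₀³ × Ē₀³` -/

section Sixfolds

/-- **EVERY NON-SPLIT WEIL-SIXFOLD COMPONENT `(3, d, [q])` (`q < 0`, `[q] ≠ [−1]`) CONTAINS A POLARIZED NON-SPLIT WEIL SIXFOLD SATISFYING THE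
HODGE CONJECTURE** — `E₀³ × Ē₀³` with a weight-`m` Segre class, `[q] = [−m]`: Weil type `(3, d)`, discriminant class `[q]`, NOT hyperbolic for that
class (van Geemen (5.4.1) contrapositive on the carriers), algebraic Weil plane, `HodgeConjectureFor A`. Through (a chart `K`-isogenous to) it,
part O-c's row `weilClassesOf_le_algebraicClasses_forall_of_lefschetzB_of_ellipticPowerTwistedSquareChart` is unconditional at the chart: on every
compact pencil of the component with its `K`-action through it, `B⋆` of the ONE 7-fold total space ⟹ the Weil Hodge conjecture for EVERY member.
[cite: vanGeemen1994HodgeAV, 4.14, 5.3–5.4 and (5.4.1)] [cite: Landherr1936HermitianForms] [cite: Deligne1982HodgeCycles, §4 Remark 4.10]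
[cite: Andre1996Motifs, §6.3 Lemme 6.3.3 and Remarque 2 (p. 33)] -/
theorem exists_hodge_nonsplit_weilSixfold_of_class (d : ℕ) (hd : 0 < d) (q : ℚˣ) (hq : (q : ℚ) < 0)
    (hne : (QuotientGroup.mk q : weilNormResidueGroup d) ≠ QuotientGroup.mk ((-1 : ℚˣ) ^ 3)) :
    ∃ (A : AbelianVariety ℂ) (φ : A ⟶ A) (e : ProjectiveEmbedding A.X) (a : complexBetti (projectiveSpace e.n ℂ) 2),
      IsRationalClass a ∧ a ≠ 0 ∧ A.dim = 2 * 3 ∧ φ ≫ φ = -(d • 𝟙 A) ∧ IsWeilType A φ 3 d ∧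
      HasWeilDiscriminantNondeg A φ 3 d
        ((d : ℂ) • complexBetti.map e.ι 2 a + complexBetti.map φ.hom.hom.hom 2 (complexBetti.map e.ι 2 a)) (QuotientGroup.mk q) ∧
      ¬ IsHyperbolicWeilType A φ 3
        ((d : ℂ) • complexBetti.map e.ι 2 a + complexBetti.map φ.hom.hom.hom 2 (complexBetti.map e.ι 2 a)) ∧
      weilClassesOf A φ 3 d ≤ algebraicClasses A.X 3 ∧ HodgeConjectureFor A.dim A.X := by
  obtain ⟨A, φ, e, a, ha, ha0, hdim, hφ, hW, hδ, hWalg, hHC⟩ :=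
    exists_hodge_polarized_weilVariety_of_class 1 d le_rfl hd q hq
  exact ⟨A, φ, e, a, ha, ha0, hdim, hφ, hW, hδ,
    not_isHyperbolicWeilType_of_hasWeilDiscriminantNondeg_ne (by norm_num) hdim hd hφ e ha ha0 hδ hne, hWalg, hHC⟩

/-- **The same indexed by a non-norm `m`**: for every `d ≥ 1` and `m ≥ 1` with `m ∉ Nm(K_dˣ)`, the component `(3, d, [−m])` contains such a
polarized non-split Weil sixfold `E₀³ × Ē₀³` satisfying HC. [cite: vanGeemen1994HodgeAV, 5.3–5.4 and (5.4.1)] [cite: Deligne1982HodgeCycles, §4 Remark 4.10] -/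
theorem exists_hodge_nonsplit_weilSixfold_of_not_mem_norm (d : ℕ) (hd : 0 < d) {m : ℕ} (hm : 0 < m)
    (hnorm : Units.mk0 (m : ℚ) (Nat.cast_ne_zero.2 hm.ne') ∉ normUnitsSubgroup ℚ (weilField d)) :
    ∃ (A : AbelianVariety ℂ) (φ : A ⟶ A) (e : ProjectiveEmbedding A.X) (a : complexBetti (projectiveSpace e.n ℂ) 2),
      IsRationalClass a ∧ a ≠ 0 ∧ A.dim = 2 * 3 ∧ φ ≫ φ = -(d • 𝟙 A) ∧ IsWeilType A φ 3 d ∧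
      HasWeilDiscriminantNondeg A φ 3 d
        ((d : ℂ) • complexBetti.map e.ι 2 a + complexBetti.map φ.hom.hom.hom 2 (complexBetti.map e.ι 2 a))
        (QuotientGroup.mk (-Units.mk0 (m : ℚ) (Nat.cast_ne_zero.2 hm.ne'))) ∧
      ¬ IsHyperbolicWeilType A φ 3
        ((d : ℂ) • complexBetti.map e.ι 2 a + complexBetti.map φ.hom.hom.hom 2 (complexBetti.map e.ι 2 a)) ∧
      weilClassesOf A φ 3 d ≤ algebraicClasses A.X 3 ∧ HodgeConjectureFor A.dim A.X := by
  have hq : ((-Units.mk0 (m : ℚ) (Nat.cast_ne_zero.2 hm.ne') : ℚˣ) : ℚ) < 0 := by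
    rw [Units.val_neg, Units.val_mk0, neg_lt_zero]; exact_mod_cast hm
  have hne : (QuotientGroup.mk (-Units.mk0 (m : ℚ) (Nat.cast_ne_zero.2 hm.ne')) : weilNormResidueGroup d) ≠
      QuotientGroup.mk ((-1 : ℚˣ) ^ 3) := by
    rw [Odd.neg_one_pow (by decide : Odd 3)]
    exact (weilNormResidueGroup_mk_neg_ne_mk_neg_one_iff _).2 hnorm
  exact exists_hodge_nonsplit_weilSixfold_of_class d hd _ hq hne

/-- **Instance: `K = ℚ(i)`, the non-split component of class `[−3]`** (`3` inert in `ℚ(i)`). [cite: Serre1973, Ch. III §1]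
[cite: vanGeemen1994HodgeAV, 5.3–5.4 and (5.4.1)] -/
theorem exists_hodge_nonsplit_weilSixfold_gaussian_three :
    ∃ (A : AbelianVariety ℂ) (φ : A ⟶ A) (e : ProjectiveEmbedding A.X) (a : complexBetti (projectiveSpace e.n ℂ) 2),
      IsRationalClass a ∧ a ≠ 0 ∧ A.dim = 2 * 3 ∧ φ ≫ φ = -((1 : ℕ) • 𝟙 A) ∧ IsWeilType A φ 3 1 ∧
      HasWeilDiscriminantNondeg A φ 3 1
        (((1 : ℕ) : ℂ) • complexBetti.map e.ι 2 a + complexBetti.map φ.hom.hom.hom 2 (complexBetti.map e.ι 2 a))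
        (QuotientGroup.mk (-Units.mk0 ((3 : ℕ) : ℚ) (by norm_num))) ∧
      ¬ IsHyperbolicWeilType A φ 3
        (((1 : ℕ) : ℂ) • complexBetti.map e.ι 2 a + complexBetti.map φ.hom.hom.hom 2 (complexBetti.map e.ι 2 a)) ∧
      weilClassesOf A φ 3 1 ≤ algebraicClasses A.X 3 ∧ HodgeConjectureFor A.dim A.X :=
  exists_hodge_nonsplit_weilSixfold_of_not_mem_norm 1 one_pos (m := 3) (by norm_num)
    (WeilCoverage.natCast_not_mem_normUnitsSubgroup_of_inert (d := 1) (a := 3) (p := 3) Nat.prime_three (by decide)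
      (dvd_refl 3) (by norm_num) (by norm_num))

end Sixfolds

end Summit.HodgeConjecture.HodgeConjecture.Ring2.AbelianAll

end
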